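import Literature.MathematicalPhysics.QuantumFieldTheory.Balaban1983to89.B8Thm4KLevelGammaGRec
import Literature.MathematicalPhysics.QuantumFieldTheory.Balaban1983to89.B8Thm4ExistsAtGammaRec

/-!
# `Balaban1983to89.B8Thm4ExistsAtGammaGRec` — [Balaban1985RegularSpaces] THEOREM 4 (p. 88), existence half in the leaf's quantifier shape, edition γ, FOR THE RECORD's
# CENTRED AVERAGING ([Balaban1987RG1] (0.4)) **WITH THE GAUGE-GROUP INVARIANT `u x ∈ G`** ([Balaban1985Averaging] p. 20; print's case of record `G = SU(N)`):
# the `G`-form of `B8Thm4ExistsAtGammaRec.thm4Exists_concrete_at_γ`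

statement-level skeleton of published theorems with citation tags; proofs where landed; nothing here is a claim about the Yang–Mills mass gap

T. Bałaban, *Spaces of regular gauge field configurations on a lattice and gauge fixing conditions*, Commun. Math. Phys. **99** (1985) 75–102 `[Balaban1985RegularSpaces]`
("[6]"): Thm 4 p. 88 («there exists a constant c₁»), (1.29) p. 81, (1.31) p. 82, (1.35) p. 82, (1.38) p. 82, (1.56) p. 86, (1.58)–(1.62) pp. 86–87, (1.66) p. 87, Prop. 5
(1.107)–(1.108) p. 94, p. 77, p. 76 («G = SU(N)»); T. Bałaban, *Averaging operations for lattice gauge theories*, CMP **98** (1985) 17–51 `[Balaban1985Averaging]` ("[3]"):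
p. 20, Prop. 4 p. 38; T. Bałaban, *Renormalization group approach to lattice gauge field theories. I*, CMP **109** (1987) 249–301 `[Balaban1987RG1]` ("[I]"): (0.3)–(0.4)
pp. 252–253; [B6] = [Balaban1984PropagatorsII] (2.3) p. 224.  STATUS: published, refereed.

CITATION HEADER (lean-in-tree rule).  Cell `pub-ymgap` (HUMAN RULING D-0062, Track A), «N05-REC» road (director-ym №254∕№255; LEAD PEN dag-n05-e), width seat
`pub-ymgap-dag-n07-w3` g12 (the N05-REC → K-road JUNCTION; ⚑ LOCATED-SU-AT-JUNCTION, cell bus 2026-08-29).  WHY THIS FILE.  The second of the three heads at which the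
record chain drops the gauge group to `U(𝔸)`: dag-n05-e's `B8Thm4ExistsAtGammaRec.thm4Exists_concrete_at_γ` (item R5, last file).  THIS FILE is the SAME theorem over
the `G`-form of the `k`-th-level head (`B8Thm4KLevelGammaGRec.thm4_exists_all_levels_supp_landau138_γ_mem`): statement byte for byte dag-n05-e's with
`(G : Subgroup 𝔸ˣ) (hG : G ≤ unitaryUnits 𝔸)` added, the two Proposition-5 socket bodies read with `v x ∈ G` ∕ `u₁ x ∈ G`, and the conclusion `u x ∈ G`; the windows
(`B8Thm4Windows.thm4_windows` ∕ `thm4_windows_extra`, dag-n05-e's `thm4_windowsZ_γ`) and the logarithm device (`logField_spec`) BY NAME; proof = dag-n05-e's, two tokens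
changed.  Engine model: `B8Thm4ExistsAtGammaG.thm4Exists_concrete_at_γ_mem` (dag-n05-e g33, pure cube).  Consumer: the `G`-form of the crown root
`B8Prop6DentedCubeMemberGammaRec.prop6_exists_dentedMember_at_γ₃` (next file), then dag-n05-e's crown tail in its `G := SU(N)` edition.  Kind «kernel-checked proof», ONE
theorem; no `def`, no `instance`, no `notation`, no existing module modified.  `--kind proof --supports stmt-QuantumFields-20541` (K0⁷-keyed, COUNT-NEUTRAL).

HONEST SCOPE: Theorem 4's existence half for the record's centred averaging MODULO its displayed socket BODIES at the datum (Prop. 5 base∕step = Sect. E; the β-shaped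
(1.59) two-line body) and the family's geometry (`hbox`, `hclass`, `hlay`); nothing of Bałaban's analysis re-proved; `HThm4Rec` UNDISCHARGED (caveat (C-S3-1)); N05 ∕ N07
NOT discharged; COUNT of record unmoved · K numerically unchanged; one finite `𝕋⁴` programme at fixed `ε`, Bałaban AS PRINTED; nothing continuum ∕ ℝ⁴ ∕ OS ∕ mass-gap ∕
Clay.  No `sorry`, no `def`.

[cite: Balaban1985RegularSpaces, Thm 4 p.88, (1.29) p.81, (1.31) p.82, (1.35) p.82, (1.38) p.82, (1.58)–(1.62) pp.86–87, Prop. 5 (1.107)–(1.108) p.94, p.76; Balaban1985Averaging, p.20, Prop. 4 p.38; Balaban1987RG1, (0.3)–(0.4) pp.252–253]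
-/

noncomputable section

namespace Literature.MathematicalPhysics.QuantumFieldTheory.Balaban1983to89.B8Thm4ExistsAtGammaGRec

open Complex (I)
open MatrixLog B7Prop1Explicit B7Prop2Explicit B7Prop1Local
open B7Eq92Concrete (mgauge mgauge_apply)
open B7Prop2Explicit (c2' c2'_pos)
open B7Prop3Flat (c3 c3_pos)
open B7Prop2Rec (C0Z C0Z_pos)
open B7Prop4GeneralLevelsRec (cZ gZ KZ gZ_nonneg)
open BlockAveragingZd (avgIterZ ctrShift)
open B7SectEFLinearisationRec (linCovIterZ)
open B8Ineq132 (covDerivFwd InAk BondTouches)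
open B8Eq119TwistedAxialRec (Restr129Z InAxZ)
open B8Eq184Proof (gaugeExp cfgExp)
open B8Lemma1NonAbelian (mulCfg)
open B8Lemma1NonAbelianRecLoops (halfVec)
open B8Eq140Level (SideTouches)
open B8Eq146AExpansion (iEta)
open B8Eq155JBound (Jcur wsup)
open B8ScaledSupNorm (bondNorm msup)
open B8Eq138LandauZd (logCfg)
open B8Eq138LandauZdRec (IsLandau138WZ)
open B8Prop3GaugeFixedKLevel (eq_mgauge_inv_of_mgauge_eq mem_unitaryUnits_of_mgauge_eq logField_spec)
open B8Thm4KLevelGammaGRec (thm4_exists_all_levels_supp_landau138_γ_mem)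
open B8Thm4ExistsAtGammaRec (thm4_windowsZ_γ)
open B8Thm4Windows (thm4_windows thm4_windows_extra mul_le_one_of_le_inv exp_le_of_small)
open B9SupplySockB9P3ZdBeta (CrossB)

-- `Site` alone could resolve to the torus sites of `Setup.lean`; re-export the `ℤ^d` sites of `B7Prop1Explicit`.
export B7Prop1Explicit (Site)

variable {d : ℕ}

variable {𝔸 : Type*} [CStarAlgebra 𝔸] [Nontrivial 𝔸]

/-! ## §1 Theorem 4, existence half at the datum, edition γ, record structure, `G`-valued gauge transformations -/

/-- ★★★ (`G`-FORM of dag-n05-e's `B8Thm4ExistsAtGammaRec.thm4Exists_concrete_at_γ`.) **THEOREM 4 (p. 88), EXISTENCE HALF, IN THE LEAF's QUANTIFIER SHAPE, THREE SOCKET BODIES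
AT THE DATUM, EDITION γ, RECORD AVERAGING, WITH THE INVARIANT `u x ∈ G`**: for a subgroup `G ≤ U(𝔸)` ([3] p. 20; [6] p. 76 «G = SU(N)»), one threshold `c₁(d, L, B₀, B₀′)`
before the data; for every datum `(U₀, U′)` in the regime with Proposition 5's fixed point `G`-VALUED at the base level and at every intermediate level (for `G`-valued `u₁`)
and the two-line (1.59) body: a `G`-VALUED `u`, `= 1` off `Ω₀`, (1.29) w.r.t. `Λs k` for the RECORD averages (`Restr129Z`), the record Landau gauge (1.38) of `U′^{u⁻¹}`
(`k ≥ 1`) and the (1.62)-shape `Lʲη|(1∕iη) log U′^{u⁻¹}| ≤ 5dLB₀(α₀+α₁)` on the sides touching `Ω_j`.  Every other binder byte for byte the unitary theorem's.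
[cite: Balaban1985RegularSpaces, Thm 4 p.88, p.76, (1.29) p.81, (1.31) p.82, (1.35) p.82, (1.38) p.82, (1.58)–(1.62) pp.86–87, (1.66) p.87, Prop. 5 (1.107)–(1.108) p.94; Balaban1985Averaging, p.20; Balaban1987RG1, (0.3)–(0.4) pp.252–253; Balaban1984PropagatorsII, (2.3) p.224] -/
theorem thm4Exists_concrete_at_γ_mem (hd2 : 2 ≤ d) {L s : ℕ} (hLs : L = 2 * s + 1) (hs : 1 ≤ s) (G : Subgroup 𝔸ˣ) (hG : G ≤ unitaryUnits 𝔸)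
    {B₀ B₀' Bbd : ℝ} (hB₀ : 0 < B₀) (hB₀' : 0 < B₀') (hB : 2 ≤ 5 * (d : ℝ) * L * B₀) (hBbd : 0 ≤ Bbd) (hBd : 4 * Bbd ≤ ((d : ℝ) * L - 1) * B₀) :
    ∃ c₁ : ℝ, 0 < c₁ ∧ ∀ (η : ℝ), 0 < η → ∀ (k : ℕ)
    (Ω : ℕ → Set (Site d)) (hΩ : ∀ j, Ω (j + 1) ⊆ Ω j) (Λs : ℕ → ℕ → Set (Site d)) (Λb : ℕ → ℕ → Set (Site d × Fin d))
    -- PRINT's box law (edition γ): the locality box of a level-`j` datum bond lies in `Ω_{j−1}` ((1.31); level 0: `Ω₀`)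
    (hbox : ∀ m, m ≤ k → ∀ j, j ≤ m → ∀ c ∈ Λb m j, ∀ x, InBox (fun i => (L : ℤ) ^ j * c.1 i - (ctrShift L j : ℤ)) (fun i => (L : ℤ) ^ j * c.1 i + (ctrShift L j : ℤ) + if i = c.2 then (L : ℤ) ^ j else 0) x → x ∈ Ω (j - 1))
    (hclass : ∀ m, m ≤ k → ∀ j, j ≤ m → ∀ c ∈ Λb m j,
      (c.1 ∈ Λs m j ∧ c.1 + e c.2 ∈ Λs m j) ∨
      (∃ j', j = j' + 1 ∧ (∀ x, (L : ℤ) • c.1 - halfVec L ≤ x → x ≤ (L : ℤ) • c.1 + halfVec L → x ∈ Λs m j') ∧ c.1 + e c.2 ∈ Λs m j) ∨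
      (∃ j', j = j' + 1 ∧ c.1 ∈ Λs m j ∧ (∀ x, (L : ℤ) • (c.1 + e c.2) - halfVec L ≤ x → x ≤ (L : ℤ) • (c.1 + e c.2) + halfVec L → x ∈ Λs m j')))
    -- the boundary-layer law of the datum's region: a site of `Ω₀` with a sup-distance-1 neighbour outside lies in `Λs m 0`, `1 ≤ m ≤ k`
    (hlay : ∀ m, 1 ≤ m → m ≤ k → ∀ y z : Site d, y ∈ Ω 0 → z ∉ Ω 0 → (∀ i, y i - 1 ≤ z i ∧ z i ≤ y i + 1) → y ∈ Λs m 0),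
      ∀ α₀ α₁ : ℝ, 0 < α₀ → 0 < α₁ → α₀ + α₁ ≤ c₁ →
      ∀ U₀ U' : Site d → Fin d → 𝔸ˣ, (∀ x κ, U₀ x κ ∈ unitaryUnits 𝔸) → (∀ x κ, U' x κ ∈ unitaryUnits 𝔸) →
      InAk L k η α₀ Ω U₀ → InAk L k η α₀ Ω (mulCfg U' U₀) → (∀ m, m ≤ k → InAxZ L m (Λs m) U₀ (mulCfg U' U₀)) →
      -- (1.35) for the datum in PRINT's class: every level-`j` bond whose box lies in `Ω_{j−1}` (p. 77 «at least one end-point in Ω»)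
      (∀ j, j ≤ k → ∀ (z : Site d) (μ : Fin d), (∀ x, InBox (fun i => (L : ℤ) ^ j * z i - (ctrShift L j : ℤ)) (fun i => (L : ℤ) ^ j * z i + (ctrShift L j : ℤ) + if i = μ then (L : ℤ) ^ j else 0) x → x ∈ Ω (j - 1)) →
        ‖(avgIterZ L (mulCfg U' U₀) j z μ : 𝔸) - (avgIterZ L U₀ j z μ : 𝔸)‖ ≤ α₁) →
      (∀ b ∈ {b : Site d × Fin d | SideTouches (Ω 0) b.1 b.2}, ‖((U' b.1 b.2 : 𝔸ˣ) : 𝔸) - 1‖ ≤ α₁) →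
      -- Proposition 5's fixed point at the base level, over THIS datum
      ((∃ (v : Site d → 𝔸ˣ) (lam : Site d → 𝔸), (∀ x, v x ∈ G) ∧ (∀ x, x ∉ Ω 0 → v x = 1) ∧
        (∀ j, j ≤ 1 → ∀ b ∈ {b : Site d × Fin d | SideTouches (Ω j) b.1 b.2}, (v b.1 : 𝔸) = ((gaugeExp lam b.1 : 𝔸ˣ) : 𝔸) ∧
        (v (b.1 + e b.2) : 𝔸) = ((gaugeExp lam (b.1 + e b.2) : 𝔸ˣ) : 𝔸)) ∧
        (∀ j, j ≤ 1 → ∀ b ∈ {b : Site d × Fin d | SideTouches (Ω j) b.1 b.2},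
        ‖lam b.1‖ ≤ (8 * B₀' * (5 * (d : ℝ) * L * B₀) * (α₀ + α₁)) ∧ ((L : ℝ) ^ j * η) * ‖covDerivFwd η U₀ b.2 lam b.1‖ ≤ (8 * B₀' * (5 * (d : ℝ) * L * B₀) * (α₀ + α₁))) ∧
        IsLandau138WZ L 1 η (Ω 0) (Λs 1) U₀ (mgauge U₀ v⁻¹ U') ∧ Restr129Z L 1 (Λs 1) U₀ ((1 : Site d → 𝔸ˣ) * v))) →
      -- Proposition 5's fixed point at every intermediate level, over THIS datum
      ((∀ m, 1 ≤ m → m < k → ∀ (u₁ : Site d → 𝔸ˣ) (U₁ : Site d → Fin d → 𝔸ˣ) (A : Site d → Fin d → 𝔸),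
        (∀ x, u₁ x ∈ G) → (∀ x, x ∉ Ω 0 → u₁ x = 1) → mgauge U₀ u₁ U₁ = U' → Restr129Z L m (Λs m) U₀ u₁ →
        IsLandau138WZ L m η (Ω 0) (Λs m) U₀ U₁ →
        (∀ j, j ≤ m → ∀ b ∈ {b : Site d × Fin d | SideTouches (Ω j) b.1 b.2},
        U₁ b.1 b.2 = cfgExp η A b.1 b.2 ∧ IsSelfAdjoint (A b.1 b.2) ∧ ‖A b.1 b.2‖ ≤ (5 * (d : ℝ) * L * B₀ * (α₀ + α₁)) * ((L : ℝ) ^ j * η)⁻¹) →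
        ∃ (v : Site d → 𝔸ˣ) (lam : Site d → 𝔸), (∀ x, v x ∈ G) ∧ (∀ x, x ∉ Ω 0 → v x = 1) ∧
        (∀ j, j ≤ m + 1 → ∀ b ∈ {b : Site d × Fin d | SideTouches (Ω j) b.1 b.2}, (v b.1 : 𝔸) = ((gaugeExp lam b.1 : 𝔸ˣ) : 𝔸) ∧
        (v (b.1 + e b.2) : 𝔸) = ((gaugeExp lam (b.1 + e b.2) : 𝔸ˣ) : 𝔸)) ∧
        (∀ j, j ≤ m + 1 → ∀ b ∈ {b : Site d × Fin d | SideTouches (Ω j) b.1 b.2},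
        ‖lam b.1‖ ≤ (8 * B₀' * (5 * (d : ℝ) * L * B₀) * (α₀ + α₁)) ∧ ((L : ℝ) ^ j * η) * ‖covDerivFwd η U₀ b.2 lam b.1‖ ≤ (8 * B₀' * (5 * (d : ℝ) * L * B₀) * (α₀ + α₁))) ∧
        IsLandau138WZ L (m + 1) η (Ω 0) (Λs (m + 1)) U₀ (mgauge U₀ v⁻¹ U₁) ∧ Restr129Z L (m + 1) (Λs (m + 1)) U₀ (u₁ * v))) →
      -- (1.59) for the fields gauge-related to THIS `U′` over THIS `U₀`
      ((∀ m, 1 ≤ m → m ≤ k → ∀ (u : Site d → 𝔸ˣ) (W : Site d → Fin d → 𝔸ˣ) (A' : Site d → Fin d → 𝔸),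
        (∀ x, u x ∈ unitaryUnits 𝔸) → (∀ x, x ∉ Ω 0 → u x = 1) → mgauge U₀ u W = U' → Restr129Z L m (Λs m) U₀ u →
        IsLandau138WZ L m η (Ω 0) (Λs m) U₀ W → (∀ y τ, IsSelfAdjoint (A' y τ)) →
        (∀ j, j ≤ m → ∀ y τ, SideTouches (Ω j) y τ →
        W y τ = cfgExp η A' y τ ∧ ‖A' y τ‖ ≤ (2 * (L * (5 * (d : ℝ) * L * B₀ * (α₀ + α₁))) + 8 * (8 * B₀' * (5 * (d : ℝ) * L * B₀) * (α₀ + α₁))) * ((L : ℝ) ^ j * η)⁻¹) →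
        (∀ y τ, (∀ j, j ≤ m → ¬ SideTouches (Ω j) y τ) → A' y τ = 0) →
        msup L m η (-(1 : ℝ)) (fun j (b : Site d × Fin d) => SideTouches (Ω j) b.1 b.2) (fun b => A' b.1 b.2)
        ≤ B₀ * (bondNorm L m η (-(3 : ℝ)) Ω (fun x μ => Jcur η U₀ A' μ x)
        + wsup 1 (fun p : {p : ℕ × (Site d × Fin d) // p.1 ≤ m ∧ (p.2 ∈ Λb m p.1 ∨ (p.1 = 0 ∧ CrossB (Ω 0) p.2))} =>
        linCovIterZ L U₀ (iEta η A') p.1.1 p.1.2.1 p.1.2.2))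
        + Bbd * msup L m η (-(1 : ℝ)) (fun j (b : Site d × Fin d) => j = 0 ∧ SideTouches (Ω 0) b.1 b.2 ∧ ¬ BondTouches (Ω 0) b.1 b.2)
            (fun b => A' b.1 b.2) ∧
        msup L m η (-(2 : ℝ)) (fun j (t : Fin d × Fin d × Site d) => SideTouches (Ω j) t.2.2 t.2.1)
        (fun t => covDerivFwd η U₀ t.1 (fun z => A' z t.2.1) t.2.2)
        ≤ B₀ * (bondNorm L m η (-(3 : ℝ)) Ω (fun x μ => Jcur η U₀ A' μ x)
        + wsup 1 (fun p : {p : ℕ × (Site d × Fin d) // p.1 ≤ m ∧ (p.2 ∈ Λb m p.1 ∨ (p.1 = 0 ∧ CrossB (Ω 0) p.2))} =>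
        linCovIterZ L U₀ (iEta η A') p.1.1 p.1.2.1 p.1.2.2))
        + Bbd * msup L m η (-(1 : ℝ)) (fun j (b : Site d × Fin d) => j = 0 ∧ SideTouches (Ω 0) b.1 b.2 ∧ ¬ BondTouches (Ω 0) b.1 b.2)
            (fun b => A' b.1 b.2))) →
      ∃ u : Site d → 𝔸ˣ, (∀ x, u x ∈ G) ∧ (∀ x, x ∉ Ω 0 → u x = 1) ∧ Restr129Z L k (Λs k) U₀ u ∧
        (1 ≤ k → IsLandau138WZ L k η (Ω 0) (Λs k) U₀ (mgauge U₀ u⁻¹ U')) ∧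
        (∀ j, j ≤ k → ∀ b ∈ {b : Site d × Fin d | SideTouches (Ω j) b.1 b.2},
          mgauge U₀ u⁻¹ U' b.1 b.2 = cfgExp η (logCfg η (mgauge U₀ u⁻¹ U')) b.1 b.2 ∧
            IsSelfAdjoint (logCfg η (mgauge U₀ u⁻¹ U') b.1 b.2) ∧
            ‖logCfg η (mgauge U₀ u⁻¹ U') b.1 b.2‖ ≤ (5 * (d : ℝ) * L * B₀ * (α₀ + α₁)) * ((L : ℝ) ^ j * η)⁻¹) := by
  have hL1 : 1 ≤ L := by omega
  have hd1 : 1 ≤ d := le_trans (by norm_num) hd2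
  have hL' : (1 : ℝ) ≤ L := by exact_mod_cast hL1
  have hd' : (1 : ℝ) ≤ d := by exact_mod_cast hd1
  obtain ⟨c₁, hc₁, hw⟩ := thm4_windows hd1 hL1 hB₀ hB₀' hB
  obtain ⟨c₂, hc₂, hw'⟩ := thm4_windows_extra (d := d) hL1
  obtain ⟨c₃, hc₃γ, hwγ⟩ := thm4_windowsZ_γ hd1 hL1 hB₀ hB₀'
  refine ⟨min (min c₁ c₂) c₃, lt_min (lt_min hc₁ hc₂) hc₃γ, ?_⟩
  intro η hη k Ω hΩ Λs Λb hbox hclass hlay α₀ α₁ hα₀ hα₁ hS U₀ U' hU₀ hU' h33 h34 hAx h135 h66 P5base P5 H59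
  have hS1 : α₀ + α₁ ≤ c₁ := hS.trans ((min_le_left _ _).trans (min_le_left _ _))
  have hS2 : α₀ + α₁ ≤ c₂ := hS.trans ((min_le_left _ _).trans (min_le_right _ _))
  have hS3 : α₀ + α₁ ≤ c₃ := hS.trans (min_le_right _ _)
  have hS0 : 0 ≤ α₀ + α₁ := by linarith
  obtain ⟨w1, w2, w3, w4, w5, w6, w7, w8, w9, w10, w11, w12, w13, w14, w15, w16, w17, w18⟩ :=
    hw α₀ α₁ hα₀ hα₁ hS1 (5 * (d : ℝ) * L * B₀ * (α₀ + α₁)) (8 * B₀' * (5 * (d : ℝ) * L * B₀) * (α₀ + α₁)) rfl rfl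
  obtain ⟨w19, w20⟩ := hw' α₀ α₁ hα₀ hα₁ hS2
  obtain ⟨g5, g6, g9, g10, g13, g14⟩ :=
    hwγ α₀ α₁ hα₀ hα₁ hS3 (5 * (d : ℝ) * L * B₀ * (α₀ + α₁)) (8 * B₀' * (5 * (d : ℝ) * L * B₀) * (α₀ + α₁)) rfl rfl
  have hcs0 : 0 ≤ 5 * (d : ℝ) * L * B₀ * (α₀ + α₁) := by positivity
  have hα₄0 : 0 ≤ 8 * B₀' * (5 * (d : ℝ) * L * B₀) * (α₀ + α₁) := by positivity
  -- the exterior-collar window at the datum's (1.66)₀ level `a := α₁`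
  have hbdry : 4 * Bbd * α₁ ≤ ((d : ℝ) * L - 1) * B₀ * (α₀ + α₁) := by
    have h1 : 4 * Bbd * α₁ ≤ ((d : ℝ) * L - 1) * B₀ * α₁ := mul_le_mul_of_nonneg_right hBd hα₁.le
    have h2 : 0 ≤ ((d : ℝ) * L - 1) * B₀ := le_trans (by positivity) hBd
    have h3 : ((d : ℝ) * L - 1) * B₀ * α₁ ≤ ((d : ℝ) * L - 1) * B₀ * (α₀ + α₁) :=
      mul_le_mul_of_nonneg_left (le_add_of_nonneg_left hα₀.le) h2
    exact h1.trans h3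
  -- EXISTENCE (support form) at the top level `k`, edition γ engine, sockets AT THE DATUM passed through
  obtain ⟨u, hu, huS, h129, W, hW, hLan, A, hA⟩ := thm4_exists_all_levels_supp_landau138_γ_mem hd2 hη hLs hs k G hG hU₀ hU'
    hα₀ hα₁ hα₄0 hB₀.le rfl w1 w2 w3 w4 g5 g6 w7 w8 g9 g10 w11 w12 w19 hBbd hα₁.le hbdry g13 g14 Ω hΩ Λs Λb hbox hclass h33 h34 hAx
    h135 h66 hlay (le_mul_of_one_le_left hα₁.le (one_le_mul_of_one_le_of_one_le hd' hL')) P5base P5 H59 k le_rfl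
  have hWeq : W = mgauge U₀ u⁻¹ U' := eq_mgauge_inv_of_mgauge_eq hW
  have hWu : ∀ x κ, W x κ ∈ unitaryUnits 𝔸 := mem_unitaryUnits_of_mgauge_eq hU₀ hU' (fun x => hG (hu x)) hW
  -- `c⋆ ≤ 1/16` for the logarithm device
  have hc16 : 5 * (d : ℝ) * L * B₀ * (α₀ + α₁) ≤ 1 / 16 := by
    have h₁ : (1 : ℝ) * (5 * (d : ℝ) * L * B₀ * (α₀ + α₁)) ≤ L * (5 * (d : ℝ) * L * B₀ * (α₀ + α₁)) :=
      mul_le_mul_of_nonneg_right hL' hcs0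
    linarith
  -- the exponent read back as `logCfg`
  have hleaf : ∀ j, j ≤ k → ∀ b ∈ {b : Site d × Fin d | SideTouches (Ω j) b.1 b.2},
      mgauge U₀ u⁻¹ U' b.1 b.2 = cfgExp η (logCfg η (mgauge U₀ u⁻¹ U')) b.1 b.2 ∧
        IsSelfAdjoint (logCfg η (mgauge U₀ u⁻¹ U') b.1 b.2) ∧
        ‖logCfg η (mgauge U₀ u⁻¹ U') b.1 b.2‖ ≤ (5 * (d : ℝ) * L * B₀ * (α₀ + α₁)) * ((L : ℝ) ^ j * η)⁻¹ := by
    intro j hj b hb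
    obtain ⟨hexp, -, hbd⟩ := hA j hj b hb
    have hbd' : ‖A b.1 b.2‖ ≤ (5 * (d : ℝ) * L * B₀ * (α₀ + α₁)) * η⁻¹ := by
      refine hbd.trans ?_
      have hLj : (1 : ℝ) ≤ (L : ℝ) ^ j := one_le_pow₀ hL'
      have : ((L : ℝ) ^ j * η)⁻¹ ≤ η⁻¹ := by
        rw [mul_inv]
        calc ((L : ℝ) ^ j)⁻¹ * η⁻¹ ≤ 1 * η⁻¹ := by gcongr; exact inv_le_one_of_one_le₀ hLj
          _ = η⁻¹ := one_mul _
      exact mul_le_mul_of_nonneg_left this hcs0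
    obtain ⟨hlogA, hsa, hWexp⟩ := logField_spec hη U₀ hWu hexp hbd' hc16
    rw [← hWeq]
    refine ⟨hWexp, ?_, ?_⟩
    · simpa [logCfg] using hsa
    · show ‖logCfg η W b.1 b.2‖ ≤ _
      rw [logCfg, hlogA]
      exact hbd
  exact ⟨u, hu, huS, h129, fun hk => hWeq ▸ hLan hk, hleaf⟩

#print axioms thm4Exists_concrete_at_γ_mem

end Literature.MathematicalPhysics.QuantumFieldTheory.Balaban1983to89.B8Thm4ExistsAtGammaGRec

end
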